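import Summits.QuantumFields.YangMills.Theorems.BalabanLadderROTSkewTorus
import Summits.QuantumFields.YangMills.Theorems.LangevinControlUVOSLegsFromFemtoAndGapStubAssemblyPermutations
import Literature.MathematicalPhysics.QuantumLattice.LatticeGaugeDLRSymmetry
import Literature.MathematicalPhysics.QuantumFieldTheory.LatticeGaugeProofs
import Literature.MathematicalPhysics.QuantumFieldTheory.LatticeGaugeStaticPotentialProofs
import HarnessLib

/-!
# Coordinate permutations act on every period cell of `ℤ⁴` — kit for the EXACT permutation half of
# `stub_cellHyperoctahedral` (route `CheckerboardTriality`, crux `TrialityOnCheckerboardCells`, stmt-QuantumFields-22666, line «coset»)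

Helper file (`--supports stmt-QuantumFields-22666 --as helper`; free-hands width seat `ym-line-sfw-p2-w4` g14; part (B) of the split
agreed on the cell bus with `ym-line-fcl-p3` g13, whose ✓`Theorems/CheckerboardTrialityCellHyperoctahedralOfTransfer.lean` (p653748)
is part (A): all of `W(B₄)` MODULO the sibling crux `CheckerboardCoverTransfer`).  Route-independent (no `Theses` import), definition-
free, 0 sorry, standard axioms.  No item is closed; no summit, no crux and no mass gap is proved by this file (R2d is a RECORD rung).

For ANY period cell `C` of `ℤ⁴` (`Theorems.ROT.PeriodCell`) whose period lattice is stable under the coordinate permutation `π` and its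
inverse (`sitePerm π±¹ (C.P) ⊆ C.P` — every `π` for the checkerboard lattices `(2L+1)·D₄`):
* §1–§2 the cell map `U ↦ (e ↦ U (toRep (π⁻¹·e.1), π⁻¹ e.2))` of skew-torus configurations intertwines the plaquette holonomies
  (`holonomy_cellPerm`), leaves the Wilson action invariant (`action_cellPerm`: half the off-diagonal double sum, `Re tr ρ(g⁻¹) = Re tr ρ(g)`),
  is a measurable automorphism preserving the product Haar measure (`exists_measurableEquiv_cellPerm`: `MeasurableEquiv.arrowCongr'` of a
  bijection of the torus edges) and hence Wilson's measure on the cell (`integral_comp_cellPerm`);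
* §3 it lifts to the coordinate permutation `relabelConfig (edgePerm π)` of the infinite lattice (`lift_cellPerm`), which commutes with
  the translations up to `sitePerm π` (`configShift_sitePerm_relabelConfig`);
* §4 ★ `moment_permSites` — the centred cell moments of every `relabelConfig (edgePerm π)`-invariant observable are invariant under
  `x ↦ (xₗ ∘ π⁻¹)ₗ`; §5 the curvature composite `r.curvature.F = Σ_{i<j} P^{ij}_0` is such an observable (`curvature_relabelConfig_edgePerm`:
  the corner `0` is fixed and the six planes are permuted — exactly what FAILS for axis flips, which move three of the six corners);
* §6 ★ `dist_linActMulti_coordPerm_of_support` — `dist_C(a·, P_π·F) = dist_C(a·, F)` as soon as the box `box 4 L ⊆ C.reps` carries the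
  support of `F(a·)` (the transversal itself need not be permutation invariant), and ★ `cellDist_linActMulti_coordPerm_eventuallyEq` — along
  ANY species scheme (`a_k L_k → ∞`) and cells with `box 4 L_k ⊆ reps_k` the two cell distributions of a compactly supported test function
  are EQUAL for all large `k`.
The stub-shaped corollary (King's class, checkerboard cells, `R` a coordinate permutation) is `Theorems/CheckerboardTrialityCellCoordPerm.lean`.

References: K. Wilson, PRD 10 (1974) 2445; E. Seiler, LNP 159 (1982) Ch. 2 (hypercubic symmetry, periodic b.c.); C. King, CMP 103 (1986) §2.
-/

set_option autoImplicit false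

noncomputable section

open scoped SchwartzMap BigOperators ENNReal
open MeasureTheory Filter Topology
open Literature.MathematicalPhysics.QuantumFieldTheory Literature.MathematicalPhysics.QuantumLattice
open Literature.MathematicalPhysics.AQFT
open Literature.Probability.LatticeModels (Site box mem_box)
open Summit.QuantumFields.YangMills.Theorems.OSLegsFromFemtoAndGap
  (permSites coordPerm coordPerm_symm_smul_siteToE sum_piFinset_box_permSites)
open Summit.QuantumFields.YangMills.Theorems.ROT (PeriodCell)

namespace Summit.QuantumFields.YangMills.Theorems.CheckerboardTrialityCellCoordPerm

/-! ## §1 Reduction to the cell and coordinate permutations of `ℤ⁴` -/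

section Reduction

variable (C : PeriodCell 4)

/-- `sitePerm τ` is compatible with subtraction. [folklore] -/
theorem sitePerm_sub (τ : Equiv.Perm (Fin 4)) (x y : Site 4) : sitePerm τ (x - y) = sitePerm τ x - sitePerm τ y := rfl

/-- Reduction to the transversal commutes with a `P`-preserving coordinate permutation, up to `P`. [cite: SeilerLNP1982, Ch. 2] -/
theorem toRep_sitePerm_red (τ : Equiv.Perm (Fin 4)) (hτ : ∀ p ∈ C.P, sitePerm τ p ∈ C.P) (y : Site 4) :
    C.toRep (sitePerm τ (C.red y)) = C.toRep (sitePerm τ y) := by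
  rw [PeriodCell.toRep_eq_toRep_iff, ← sitePerm_sub]
  exact hτ _ (C.red_sub_mem y)

/-- The same with the representative coerced back to `ℤ⁴`. [cite: SeilerLNP1982, Ch. 2] -/
theorem toRep_sitePerm_coe_toRep (τ : Equiv.Perm (Fin 4)) (hτ : ∀ p ∈ C.P, sitePerm τ p ∈ C.P) (y : Site 4) :
    C.toRep (sitePerm τ ((C.toRep y : C.TSite) : Site 4)) = C.toRep (sitePerm τ y) :=
  toRep_sitePerm_red C τ hτ y

/-- A `P`-preserving coordinate permutation maps neighbours to neighbours on the cell:
`toRep (τ·(x + eᵢ)) = toRep (τ·x) + e_{τ i}`. [cite: SeilerLNP1982, Ch. 2] -/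
theorem toRep_sitePerm_shift (τ : Equiv.Perm (Fin 4)) (hτ : ∀ p ∈ C.P, sitePerm τ p ∈ C.P) (x : C.TSite) (i : Fin 4) :
    C.toRep (sitePerm τ ((C.shift x i : C.TSite) : Site 4)) = C.shift (C.toRep (sitePerm τ (x : Site 4))) (τ i) := by
  simp only [PeriodCell.shift, PeriodCell.coe_toRep]
  rw [toRep_sitePerm_red C τ hτ, Literature.MathematicalPhysics.QuantumLattice.sitePerm_add, Literature.MathematicalPhysics.QuantumLattice.sitePerm_single, PeriodCell.toRep_eq_toRep_iff,
    add_sub_add_right_eq_sub]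
  have h := C.P.neg_mem (C.red_sub_mem (sitePerm τ (x : Site 4)))
  rwa [neg_sub] at h

/-- The site bijection `x ↦ toRep (τ⁻¹·x)` of the cell induced by a coordinate permutation preserving `P` both ways. [cite: SeilerLNP1982, Ch. 2] -/
theorem exists_tsitePerm (π : Equiv.Perm (Fin 4)) (hπ : ∀ p ∈ C.P, sitePerm π p ∈ C.P)
    (hπ' : ∀ p ∈ C.P, sitePerm π.symm p ∈ C.P) :
    ∃ e : C.TSite ≃ C.TSite, ∀ x, e x = C.toRep (sitePerm π.symm (x : Site 4)) :=
  ⟨{ toFun := fun x => C.toRep (sitePerm π.symm (x : Site 4))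
     invFun := fun x => C.toRep (sitePerm π (x : Site 4))
     left_inv := fun x => by
       simp only
       rw [toRep_sitePerm_coe_toRep C π hπ, ← Literature.MathematicalPhysics.QuantumLattice.sitePerm_symm, Equiv.apply_symm_apply, PeriodCell.toRep_coe]
     right_inv := fun x => by
       simp only
       rw [toRep_sitePerm_coe_toRep C π.symm hπ', ← Literature.MathematicalPhysics.QuantumLattice.sitePerm_symm, Equiv.symm_apply_apply, PeriodCell.toRep_coe] },
    fun _ => rfl⟩

end Reduction

/-! ## §2 The cell map: holonomies, the Wilson action, the product Haar measure, Wilson's measure -/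

section CellMap

variable (C : PeriodCell 4) {G : Type*} [Group G]

/-- The degenerate holonomy `U_{x;ii}` is `1`. [folklore] -/
theorem holonomy_self (U : C.Config G) (x : C.TSite) (i : Fin 4) : C.holonomy U x i i = 1 := by
  simp [PeriodCell.holonomy]

/-- Exchanging the two directions inverts the holonomy. [cite: Wilson1974] -/
theorem holonomy_swap (U : C.Config G) (x : C.TSite) (i j : Fin 4) : C.holonomy U x j i = (C.holonomy U x i j)⁻¹ := by
  simp only [PeriodCell.holonomy, mul_inv_rev, inv_inv, mul_assoc]

/-- **The cell map intertwines the plaquette holonomies**: the holonomy of the permuted configuration around `(x; i, j)` is the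
holonomy of the original one around `(toRep (π⁻¹·x); π⁻¹ i, π⁻¹ j)`. [cite: SeilerLNP1982, Ch. 2] -/
theorem holonomy_cellPerm (π : Equiv.Perm (Fin 4)) (hπ' : ∀ p ∈ C.P, sitePerm π.symm p ∈ C.P) (U : C.Config G)
    (x : C.TSite) (i j : Fin 4) :
    C.holonomy (fun e : C.TEdge => U (C.toRep (sitePerm π.symm (e.1 : Site 4)), π.symm e.2)) x i j =
      C.holonomy U (C.toRep (sitePerm π.symm (x : Site 4))) (π.symm i) (π.symm j) := by
  simp only [PeriodCell.holonomy, toRep_sitePerm_shift C π.symm hπ']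

variable {N : ℕ} (ρ : G →* Matrix (Fin N) (Fin N) ℂ) [TopologicalSpace G] [IsTopologicalGroup G] [CompactSpace G]

/-- The Wilson action of the cell as half the off-diagonal double sum over ordered pairs of directions (the diagonal terms vanish and
`Re tr ρ(U_p⁻¹) = Re tr ρ(U_p)` for a continuous representation of a compact group). [cite: Wilson1974] -/
theorem action_eq_half_sum (hρ : Continuous ρ) (U : C.Config G) :
    C.action ρ U = ∑ x : C.TSite, (1 / 2) * ∑ i : Fin 4, ∑ j : Fin 4, ((N : ℝ) - (ρ (C.holonomy U x i j)).trace.re) := by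
  unfold PeriodCell.action
  rw [Fintype.sum_prod_type]
  refine Finset.sum_congr rfl fun x _ => ?_
  refine StaticPotential.sum_lt_eq_half_sum (fun i j => (N : ℝ) - (ρ (C.holonomy U x i j)).trace.re)
    (fun i j => ?_) (fun i => ?_)
  · simp only [holonomy_swap C U x i j, Literature.RepresentationTheory.CompactGroups.CompactGroup.re_trace_map_inv ρ hρ]
  · simp [holonomy_self C, Matrix.trace_one]

/-- **The Wilson action of the cell is invariant under the cell map** of a coordinate permutation preserving `P` both ways.
[cite: SeilerLNP1982, Ch. 2] -/
theorem action_cellPerm (hρ : Continuous ρ) (π : Equiv.Perm (Fin 4)) (hπ : ∀ p ∈ C.P, sitePerm π p ∈ C.P)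
    (hπ' : ∀ p ∈ C.P, sitePerm π.symm p ∈ C.P) (U : C.Config G) :
    C.action ρ (fun e : C.TEdge => U (C.toRep (sitePerm π.symm (e.1 : Site 4)), π.symm e.2)) = C.action ρ U := by
  rw [action_eq_half_sum C ρ hρ, action_eq_half_sum C ρ hρ]
  simp only [holonomy_cellPerm C π hπ' U]
  obtain ⟨e, he⟩ := exists_tsitePerm C π hπ hπ'
  refine Fintype.sum_equiv e _ _ fun x => ?_
  rw [he]
  congr 1
  exact Fintype.sum_equiv π.symm _ _ fun i => Fintype.sum_equiv π.symm _ _ fun j => rfl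

variable [MeasurableSpace G] [BorelSpace G]

/-- **The cell map is a measurable automorphism preserving the product Haar measure** (it is `MeasurableEquiv.arrowCongr'` of the
edge bijection `(x, i) ↦ (toRep (π·x), π i)`). [folklore] -/
theorem exists_measurableEquiv_cellPerm (π : Equiv.Perm (Fin 4)) (hπ : ∀ p ∈ C.P, sitePerm π p ∈ C.P)
    (hπ' : ∀ p ∈ C.P, sitePerm π.symm p ∈ C.P) :
    ∃ Φ : C.Config G ≃ᵐ C.Config G,
      (∀ U : C.Config G, Φ U = fun e : C.TEdge => U (C.toRep (sitePerm π.symm (e.1 : Site 4)), π.symm e.2)) ∧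
      MeasurePreserving Φ (Measure.pi fun _ : C.TEdge => haarProbability G)
        (Measure.pi fun _ : C.TEdge => haarProbability G) := by
  let ε : C.TEdge ≃ C.TEdge :=
    { toFun := fun e => (C.toRep (sitePerm π (e.1 : Site 4)), π e.2)
      invFun := fun e => (C.toRep (sitePerm π.symm (e.1 : Site 4)), π.symm e.2)
      left_inv := fun e => by
        refine Prod.ext ?_ (π.symm_apply_apply e.2)
        simp only
        rw [toRep_sitePerm_coe_toRep C π.symm hπ', ← Literature.MathematicalPhysics.QuantumLattice.sitePerm_symm, Equiv.symm_apply_apply, PeriodCell.toRep_coe]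
      right_inv := fun e => by
        refine Prod.ext ?_ (π.apply_symm_apply e.2)
        simp only
        rw [toRep_sitePerm_coe_toRep C π hπ, ← Literature.MathematicalPhysics.QuantumLattice.sitePerm_symm, Equiv.apply_symm_apply, PeriodCell.toRep_coe] }
  refine ⟨MeasurableEquiv.arrowCongr' ε (MeasurableEquiv.refl G), fun U => rfl, ?_⟩
  exact measurePreserving_arrowCongr' (fun _ : C.TEdge => haarProbability G) (fun _ : C.TEdge => haarProbability G) ε
    (MeasurableEquiv.refl G) fun _ => MeasurePreserving.id _

/-- **Change of variables in Wilson's measure of the cell**: `∫ g(π·U) dμ_C(U) = ∫ g(U) dμ_C(U)` for every integrand `g` (the cell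
map preserves the product Haar measure and the Wilson density). [cite: SeilerLNP1982, Ch. 2] -/
theorem integral_comp_cellPerm (hρ : Continuous ρ) (β : ℝ) (π : Equiv.Perm (Fin 4)) (hπ : ∀ p ∈ C.P, sitePerm π p ∈ C.P)
    (hπ' : ∀ p ∈ C.P, sitePerm π.symm p ∈ C.P) (g : C.Config G → ℝ) :
    ∫ U, g (fun e : C.TEdge => U (C.toRep (sitePerm π.symm (e.1 : Site 4)), π.symm e.2)) ∂(C.measure ρ β) =
      ∫ U, g U ∂(C.measure ρ β) := by
  obtain ⟨Φ, hΦ, hpi⟩ := exists_measurableEquiv_cellPerm C (G := G) π hπ hπ'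
  have hmp : MeasurePreserving Φ (C.measure (G := G) ρ β) (C.measure (G := G) ρ β) := by
    refine ⟨Φ.measurable, ?_⟩
    simp only [PeriodCell.measure, Measure.map_smul, PeriodCell.weight]
    rw [withDensity_map_of_measurableEquiv _ _ _ hpi.map_eq]
    intro U
    simp only [hΦ U, action_cellPerm C ρ hρ π hπ hπ']
  have h := hmp.integral_comp' g
  simp only [hΦ] at h
  exact h

end CellMap

/-! ## §3 The periodic lift and the translations -/

section Lift

variable (C : PeriodCell 4) {G : Type*} [MeasurableSpace G]

/-- **The cell map lifts to the coordinate permutation of the infinite lattice**: `lift (π·U) = relabelConfig (edgePerm π) (lift U)`.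
[cite: SeilerLNP1982, Ch. 2] -/
theorem lift_cellPerm (π : Equiv.Perm (Fin 4)) (hπ' : ∀ p ∈ C.P, sitePerm π.symm p ∈ C.P) (U : C.Config G) :
    C.lift (fun e : C.TEdge => U (C.toRep (sitePerm π.symm (e.1 : Site 4)), π.symm e.2)) =
      relabelConfig (edgePerm π) (C.lift U) := by
  funext e
  simp only [PeriodCell.lift_apply, relabelConfig_apply, edgePerm_symm_apply, PeriodCell.coe_toRep]
  rw [toRep_sitePerm_red C π.symm hπ']

omit C in
/-- Translating by `π·v` after permuting the coordinates is permuting after translating by `v`. [cite: Georgii2011, §5.1 (5.3)] -/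
theorem configShift_sitePerm_relabelConfig (π : Equiv.Perm (Fin 4)) (v : Site 4) (V : LGConfig 4 G) :
    configShift (sitePerm π v) (relabelConfig (edgePerm π) V) = relabelConfig (edgePerm π) (configShift v V) := by
  funext e
  simp only [configShift_apply, relabelConfig_apply, edgePerm_symm_apply]
  congr 1
  refine Prod.ext ?_ rfl
  funext k
  simp [Literature.MathematicalPhysics.QuantumLattice.sitePerm_apply]

end Lift

/-! ## §4 ★ The centred cell moments are invariant under coordinate permutations of the sites -/

section Moments

variable (C : PeriodCell 4) {G : Type*} [Group G] {N : ℕ} (ρ : G →* Matrix (Fin N) (Fin N) ℂ)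
  [TopologicalSpace G] [IsTopologicalGroup G] [CompactSpace G] [MeasurableSpace G] [BorelSpace G]

/-- ★ **Invariance of the centred cell moments under coordinate permutations.**  For a period cell whose period lattice is stable
under `π` and `π⁻¹` and an observable `O` of the infinite lattice invariant under `relabelConfig (edgePerm π)`,
`W_C(π·x₁, …, π·xₙ) = W_C(x₁, …, xₙ)` (`(π·x)ᵢ = x_{π⁻¹ i}`; change of variables by the cell map, §2–§3). [cite: SeilerLNP1982, Ch. 2] -/
theorem moment_permSites (hρ : Continuous ρ) (β : ℝ) (π : Equiv.Perm (Fin 4)) (hπ : ∀ p ∈ C.P, sitePerm π p ∈ C.P)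
    (hπ' : ∀ p ∈ C.P, sitePerm π.symm p ∈ C.P) (O : LGConfig 4 G → ℝ)
    (hO : ∀ V : LGConfig 4 G, O (relabelConfig (edgePerm π) V) = O V) (m : ℝ) {n : ℕ} (x : Fin n → Site 4) :
    C.moment ρ β O m (permSites π x) = C.moment ρ β O m x := by
  unfold PeriodCell.moment
  have h := integral_comp_cellPerm C ρ hρ β π hπ hπ'
    (fun U => ∏ i, (O (configShift (-(permSites π x i)) (C.lift U)) - m))
  refine h.symm.trans (integral_congr_ae (Eventually.of_forall fun U => ?_))
  beta_reduce
  refine Finset.prod_congr rfl fun i _ => ?_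
  rw [lift_cellPerm C π hπ' U, show -(permSites π x i) = sitePerm π (-(x i)) from rfl,
    configShift_sitePerm_relabelConfig, hO]

end Moments

/-! ## §5 The curvature composite is invariant under coordinate permutations -/

section Curvature

variable {G : Type} [Group G] {N : ℕ} (ρ : G →* Matrix (Fin N) (Fin N) ℂ)
  [TopologicalSpace G] [IsTopologicalGroup G] [CompactSpace G] [MeasurableSpace G]

omit [TopologicalSpace G] [IsTopologicalGroup G] [CompactSpace G] in
/-- The plaquette at the origin of the permuted configuration is the plaquette at the origin in the permuted plane.
[cite: SeilerLNP1982, Ch. 2] -/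
theorem plaquetteObs_zero_relabelConfig_edgePerm (π : Equiv.Perm (Fin 4)) (i j : Fin 4) (V : LGConfig 4 G) :
    plaquetteObs ρ 0 i j (relabelConfig (edgePerm π) V) = plaquetteObs ρ 0 (π.symm i) (π.symm j) V := by
  unfold plaquetteObs
  have h := plaquetteHolonomyZd_relabel_edgePerm π V 0 (π.symm i) (π.symm j)
  rw [Equiv.apply_symm_apply, Equiv.apply_symm_apply, show sitePerm π (0 : Site 4) = 0 from rfl] at h
  rw [h]

omit [MeasurableSpace G] in
/-- The Wilson action density at the origin as half the off-diagonal double sum of the plaquettes at the origin. [cite: Wilson1974] -/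
theorem actionDensity_eq_half_sum (hρ : Continuous ρ) (V : LGConfig 4 G) :
    actionDensity ρ V = (1 / 2) * ∑ i : Fin 4, ∑ j : Fin 4, (if i = j then 0 else plaquetteObs ρ 0 i j V) := by
  have hsymm : ∀ i j : Fin 4, plaquetteObs ρ 0 j i V = plaquetteObs ρ 0 i j V := by
    intro i j
    unfold plaquetteObs
    rw [plaquetteHolonomyZd_swap, Literature.RepresentationTheory.CompactGroups.CompactGroup.re_trace_map_inv ρ hρ]
  have h1 : actionDensity ρ V = ∑ q : {q : Fin 4 × Fin 4 // q.1 < q.2}, plaquetteObs ρ 0 q.1.1 q.1.2 V := by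
    unfold actionDensity
    rw [← Finset.sum_product' (s := Finset.univ) (t := Finset.univ)
      (f := fun i j => if i < j then plaquetteObs ρ 0 i j V else 0), Finset.univ_product_univ, ← Finset.sum_filter]
    exact Finset.sum_subtype _ (fun q => by simp) fun q : Fin 4 × Fin 4 => plaquetteObs ρ 0 q.1 q.2 V
  have h2 : ∑ q : {q : Fin 4 × Fin 4 // q.1 < q.2}, plaquetteObs ρ 0 q.1.1 q.1.2 V =
      ∑ q : {q : Fin 4 × Fin 4 // q.1 < q.2}, (if q.1.1 = q.1.2 then 0 else plaquetteObs ρ 0 q.1.1 q.1.2 V) :=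
    Finset.sum_congr rfl fun q _ => by rw [if_neg (ne_of_lt q.2)]
  rw [h1, h2]
  refine StaticPotential.sum_lt_eq_half_sum (fun i j => if i = j then (0 : ℝ) else plaquetteObs ρ 0 i j V)
    (fun i j => ?_) (fun i => by simp)
  by_cases hij : i = j
  · simp [hij]
  · simp [hij, Ne.symm hij, hsymm i j]

/-- **The Wilson action density at the origin is invariant under the coordinate permutations of the infinite lattice** (corner `0`
is fixed and the six planes are permuted). [cite: SeilerLNP1982, Ch. 2] -/
theorem actionDensity_relabelConfig_edgePerm (hρ : Continuous ρ) (π : Equiv.Perm (Fin 4)) (V : LGConfig 4 G) :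
    actionDensity ρ (relabelConfig (edgePerm π) V) = actionDensity ρ V := by
  rw [actionDensity_eq_half_sum ρ hρ, actionDensity_eq_half_sum ρ hρ]
  simp only [plaquetteObs_zero_relabelConfig_edgePerm]
  congr 1
  exact Fintype.sum_equiv π.symm _ _ fun i => Fintype.sum_equiv π.symm _ _ fun j => by
    simp only [EmbeddingLike.apply_eq_iff_eq]

/-- **The curvature composite `r.curvature.F` is invariant under the coordinate permutations of the infinite lattice.**
[cite: SeilerLNP1982, Ch. 2] -/
theorem curvature_relabelConfig_edgePerm [BorelSpace G] (r : LatticeRep G) (π : Equiv.Perm (Fin 4)) (V : LGConfig 4 G) :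
    r.curvature.F (relabelConfig (edgePerm π) V) = r.curvature.F V :=
  actionDensity_relabelConfig_edgePerm r.ρ r.continuous π V

end Curvature

/-! ## §6 ★ The cell distributions under coordinate permutations -/

section Dist

variable (C : PeriodCell 4) {G : Type*} [Group G] {N : ℕ} (ρ : G →* Matrix (Fin N) (Fin N) ℂ)
  [TopologicalSpace G] [IsTopologicalGroup G] [CompactSpace G] [MeasurableSpace G] [BorelSpace G]

omit C in
/-- Multi-sites of the box stay in the box under a coordinate permutation. [folklore] -/
theorem permSites_mem_piFinset_box_iff (τ : Equiv.Perm (Fin 4)) (L : ℕ) {n : ℕ} (x : Fin n → Site 4) :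
    permSites τ x ∈ Fintype.piFinset (fun _ : Fin n => box 4 L) ↔ x ∈ Fintype.piFinset (fun _ : Fin n => box 4 L) := by
  simp only [Fintype.mem_piFinset, mem_box, permSites]
  constructor
  · intro h l i
    simpa using h l (τ i)
  · intro h l i
    exact h l _

/-- ★ **Exact invariance of the cell distributions under coordinate permutations, given the support.**  If the test function
`F(a·)` vanishes at every multi-site outside the box `box 4 L ⊆ C.reps`, then `dist_C(a·, P_π·F) = dist_C(a·, F)` for every
`relabelConfig (edgePerm π)`-invariant observable (`P_π⁻¹(a x) = a (x ∘ π)`, reindex the box, §4). [cite: King1986, §2] -/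
theorem dist_linActMulti_coordPerm_of_support (hρ : Continuous ρ) (β : ℝ) (π : Equiv.Perm (Fin 4))
    (hπ : ∀ p ∈ C.P, sitePerm π p ∈ C.P) (hπ' : ∀ p ∈ C.P, sitePerm π.symm p ∈ C.P) {L : ℕ} (hbox : box 4 L ⊆ C.reps) (a : ℝ)
    (O : LGConfig 4 G → ℝ) (hO : ∀ V : LGConfig 4 G, O (relabelConfig (edgePerm π) V) = O V) (m : ℝ) {n : ℕ}
    (F : 𝓢((Fin n → EuclideanSpace ℝ (Fin 4)), ℂ))
    (hF : ∀ x : Fin n → Site 4, F (fun l => a • siteToE (x l)) ≠ 0 → x ∈ Fintype.piFinset fun _ : Fin n => box 4 L) :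
    C.dist ρ β (fun z => a • siteToE z) O m n (linActMulti (coordPerm π) F) = C.dist ρ β (fun z => a • siteToE z) O m n F := by
  have hsub : Fintype.piFinset (fun _ : Fin n => box 4 L) ⊆ Fintype.piFinset (fun _ : Fin n => C.reps) :=
    Fintype.piFinset_subset _ _ fun _ => hbox
  rw [PeriodCell.dist_apply, PeriodCell.dist_apply]
  simp_rw [linActMulti_apply, coordPerm_symm_smul_siteToE]
  have hL : ∑ x ∈ Fintype.piFinset (fun _ : Fin n => C.reps),
      ((C.moment (G := G) ρ β O m x : ℝ) : ℂ) * F (fun l => a • siteToE (fun i => x l (π i))) =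
      ∑ x ∈ Fintype.piFinset (fun _ : Fin n => box 4 L),
        ((C.moment (G := G) ρ β O m x : ℝ) : ℂ) * F (fun l => a • siteToE (fun i => x l (π i))) := by
    refine (Finset.sum_subset hsub fun x _ hx => ?_).symm
    have h0 : F (fun l => a • siteToE (fun i => x l (π i))) = 0 := by
      by_contra h
      have hmem := hF (permSites π.symm x) h
      exact hx ((permSites_mem_piFinset_box_iff π.symm L x).1 hmem)
    rw [h0, mul_zero]
  have hR : ∑ x ∈ Fintype.piFinset (fun _ : Fin n => C.reps),
      ((C.moment (G := G) ρ β O m x : ℝ) : ℂ) * F (fun l => a • siteToE (x l)) =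
      ∑ x ∈ Fintype.piFinset (fun _ : Fin n => box 4 L),
        ((C.moment (G := G) ρ β O m x : ℝ) : ℂ) * F (fun l => a • siteToE (x l)) := by
    refine (Finset.sum_subset hsub fun x _ hx => ?_).symm
    have h0 : F (fun l => a • siteToE (x l)) = 0 := by
      by_contra h
      exact hx (hF x h)
    rw [h0, mul_zero]
  rw [hL, hR, ← sum_piFinset_box_permSites π L]
  refine Finset.sum_congr rfl fun x _ => ?_
  rw [moment_permSites C ρ hρ β π hπ hπ' O hO m x]
  simp [permSites]

/-- ★ **Along a scheme the cell distributions of `P_π·F` and `F` coincide for all large `k`.**  For any species scheme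
(`a_k L_k → ∞`), any cells with `box 4 L_k ⊆ reps_k` and period lattices stable under `π±¹`, any `relabelConfig (edgePerm π)`-invariant
observable and any compactly supported test function `F`: eventually `dist_{C_k}(a_k·, P_π·F) = dist_{C_k}(a_k·, F)` (the support of
`F(a_k·)` lies in the box once `a_k L_k` exceeds the radius of the support). [cite: King1986, §2] -/
theorem cellDist_linActMulti_coordPerm_eventuallyEq (hρ : Continuous ρ) (π : Equiv.Perm (Fin 4)) {ι : Type}
    (sch : SpeciesScheme ι) (βk mk : ℕ → ℝ) (Ck : ℕ → PeriodCell 4) (hreps : ∀ k, box 4 (sch.L k) ⊆ (Ck k).reps)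
    (hπ : ∀ k, ∀ p ∈ (Ck k).P, sitePerm π p ∈ (Ck k).P) (hπ' : ∀ k, ∀ p ∈ (Ck k).P, sitePerm π.symm p ∈ (Ck k).P)
    (O : LGConfig 4 G → ℝ) (hO : ∀ V : LGConfig 4 G, O (relabelConfig (edgePerm π) V) = O V) {n : ℕ}
    (F : 𝓢((Fin n → EuclideanSpace ℝ (Fin 4)), ℂ)) (hFc : HasCompactSupport (F : (Fin n → EuclideanSpace ℝ (Fin 4)) → ℂ)) :
    ∀ᶠ k in atTop, (Ck k).dist ρ (βk k) (fun z => (sch.a k) • siteToE z) O (mk k) n (linActMulti (coordPerm π) F) =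
      (Ck k).dist ρ (βk k) (fun z => (sch.a k) • siteToE z) O (mk k) n F := by
  obtain ⟨R, hR⟩ := hFc.isCompact.isBounded.subset_closedBall (0 : Fin n → EuclideanSpace ℝ (Fin 4))
  filter_upwards [sch.tendsto_L.eventually_gt_atTop R] with k hk
  refine dist_linActMulti_coordPerm_of_support (Ck k) ρ hρ (βk k) π (hπ k) (hπ' k) (hreps k) (sch.a k) O hO (mk k) F
    fun x hx => ?_
  rw [Fintype.mem_piFinset]
  intro l
  rw [mem_box]
  intro i
  have hmem : (fun l => sch.a k • siteToE (x l)) ∈ Metric.closedBall (0 : Fin n → EuclideanSpace ℝ (Fin 4)) R :=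
    hR (subset_tsupport _ (Function.mem_support.2 hx))
  rw [Metric.mem_closedBall, dist_zero_right] at hmem
  have h1 : ‖(sch.a k • siteToE (x l) : EuclideanSpace ℝ (Fin 4))‖ ≤ R := (norm_le_pi_norm (fun l => sch.a k • siteToE (x l)) l).trans hmem
  have h2 : sch.a k * |((x l i : ℤ) : ℝ)| ≤ R := by
    have h := (PiLp.norm_apply_le (sch.a k • siteToE (x l) : EuclideanSpace ℝ (Fin 4)) i).trans h1
    simp only [PiLp.smul_apply, siteToE_apply, smul_eq_mul, norm_mul, Real.norm_eq_abs,
      abs_of_pos (sch.a_pos k)] at h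
    exact h
  have h3 : |((x l i : ℤ) : ℝ)| < (sch.L k : ℝ) :=
    lt_of_mul_lt_mul_left (h2.trans_lt hk) (sch.a_pos k).le
  have h4 : |x l i| < (sch.L k : ℤ) := by exact_mod_cast h3
  obtain ⟨h5, h6⟩ := abs_lt.1 h4
  exact ⟨h5.le, h6.le⟩

end Dist

end Summit.QuantumFields.YangMills.Theorems.CheckerboardTrialityCellCoordPerm

end
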